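import Summits.FinalStateConjecture.FinalStateConjecture.Theses.PhotonSphereChannels
import Summits.FinalStateConjecture.FinalStateConjecture.Theses.PhaseMixingCapture

/-!
# Route PhotonSphereChannels · item `TameCensorship` (stmt-FinalStateConjecture-17431, formerly 10047) —
# K3 contains the summit's weak-cosmic-censorship crux (helper file, `--supports`)

`Summit.FinalStateConjecture.FinalStateConjecture.Theses.PhotonSphereChannels.TameCensorship` (K3 of
route PhotonSphereChannels) asserts, for every connected Hausdorff second countable `3`-manifold
`Σ`, Christodoulou-genericity (codimension `≥ 1`, curve form, inside `admissibleVacuumData Σ`) of the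
property "an MGHD exists ∧ every MGHD has complete `𝓘⁺` ∧ no extremal-Kerr remnant ∧ `C³`-bounded
outer geometry". The crux `…Theses.PhaseMixingCapture.WeakCosmicCensorshipMGHD`
(stmt-FinalStateConjecture-9952, shared by several routes as "the first conjunct-structure of the
summit statement") asserts the same genericity of the property "an MGHD exists ∧ every MGHD has
complete `𝓘⁺`" — verbatim the first two conjuncts of K3's property.

This file lands the formal certificate that **K3 implies stmt-9952**:
`weakCosmicCensorshipMGHD_of_tameCensorship : TameCensorship → WeakCosmicCensorshipMGHD`, by
monotonicity of curve-genericity in the property (the already landed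
`Theorems.CaptureSuffices.Negative.isChristodoulouGeneric_mono`). Pure logic, `sorry`-free; it is an
implication between two OPEN cruxes and closes neither. Consequence for the ledger: K3 cannot be
settled positively before the weak-cosmic-censorship crux stmt-FinalStateConjecture-9952 is, and a
refutation of stmt-9952 refutes K3. (The converse split "K3 ↔ 9952 ∧ generic third law ∧ generic
tameness" is not available as logic: curve-genericity is not closed under conjunction,
`Theorems.TameCensorship.Negative.isChristodoulouGeneric_and_fails`.) No definition is introduced;
nothing is restated as a fact.
-/

set_option linter.dupNamespace false

noncomputable section

namespace Summit.FinalStateConjecture.FinalStateConjecture.Theorems.PhotonSphereChannels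

open Literature.Geometry.Lorentzian
open Summit.FinalStateConjecture.FinalStateConjecture.Theses.PhotonSphereChannels (TameCensorship)
open Summit.FinalStateConjecture.FinalStateConjecture.Theses.PhaseMixingCapture
  (WeakCosmicCensorshipMGHD)
-- (buildfix 2026-08-20: the monotonicity step formerly imported from
-- `Theorems.CaptureSuffices.Negative.CounterexampleShape` — a pre-T2 module that no longer builds — is
-- inlined below as a local `have`; the import now is the route file PhaseMixingCapture it came through.)

/-- **K3 contains weak cosmic censorship (MGHD form).** The route's complement crux
`TameCensorship` (stmt-FinalStateConjecture-10047) implies the summit's weak-cosmic-censorship crux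
`WeakCosmicCensorshipMGHD` (stmt-FinalStateConjecture-9952): on each `3`-manifold `Σ` the tame
property "MGHD exists ∧ every MGHD has complete `𝓘⁺` ∧ no extremal remnant ∧ bounded outer
geometry" implies pointwise the censorship property "MGHD exists ∧ every MGHD has complete `𝓘⁺`"
(drop the last two conjuncts), and curve-genericity is monotone in the property
(`CaptureSuffices.Negative.isChristodoulouGeneric_mono`). An implication between two open cruxes;
it closes neither. -/
theorem weakCosmicCensorshipMGHD_of_tameCensorship (hK3 : TameCensorship) :
    WeakCosmicCensorshipMGHD := by
  unfold Summit.FinalStateConjecture.FinalStateConjecture.Theses.PhaseMixingCapture.WeakCosmicCensorshipMGHD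
  intro X _ _ _ _ _ _
  -- rev ≥ 15: K3 is TAME-generic; tame genericity implies the topology-free notion
  -- (`IsTameChristodoulouGeneric.isChristodoulouGeneric`), then monotonicity in the property
  have mono : ∀ {P Q : _ → Prop},
      (∀ d ∈ admissibleVacuumData X, P d → Q d) →
        InitialDataSet.IsChristodoulouGeneric (admissibleVacuumData X) P 1 →
          InitialDataSet.IsChristodoulouGeneric (admissibleVacuumData X) Q 1 := by
    intro P Q hPQ h d hd
    obtain ⟨F, hF, h0, hinj, hadm, hexc⟩ := h d ⟨hd.1, fun hP ↦ hd.2 (hPQ d hd.1 hP)⟩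
    exact ⟨F, hF, h0, hinj, hadm, fun c hc hmem ↦ hexc c hc ⟨hmem.1, fun hP ↦ hmem.2 (hPQ _ hmem.1 hP)⟩⟩
  exact mono (fun D _ hD ↦ ⟨hD.1, fun 𝒟 h𝒟 ↦ (hD.2 𝒟 h𝒟).1⟩) (hK3 X).isChristodoulouGeneric

/-- **Registered form** (stub of the crux item stmt-FinalStateConjecture-17431, line `Sketch`): K3 implies the
shared weak-cosmic-censorship item stmt-FinalStateConjecture-9952, fully qualified. -/
theorem stub_tameCensorship_imp_weakCosmicCensorshipMGHD : Summit.FinalStateConjecture.FinalStateConjecture.Theses.PhotonSphereChannels.TameCensorship → Summit.FinalStateConjecture.FinalStateConjecture.Theses.PhaseMixingCapture.WeakCosmicCensorshipMGHD :=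
  weakCosmicCensorshipMGHD_of_tameCensorship

end Summit.FinalStateConjecture.FinalStateConjecture.Theorems.PhotonSphereChannels

end
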